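import Mathlib
import Summits.Ventures.PercRepro2.Defs
import Summits.Ventures.PercRepro2.Independence
import Summits.Ventures.PercRepro2.Harris
import Summits.Ventures.PercRepro2.Graph
import Summits.Ventures.PercRepro2.Exploration
import Summits.Ventures.PercRepro2.Events
import Summits.Ventures.PercRepro2.Induced
import Summits.Ventures.PercRepro2.BHK
import Summits.Ventures.PercRepro2.BHKEvents
import Summits.Ventures.PercRepro2.OneEdge
import Summits.Ventures.PercRepro2.RBRoot
import Summits.Ventures.PercRepro2.RBRootEdge
import Summits.Ventures.PercRepro2.RBRootEdgePin
import Summits.Ventures.PercRepro2.RBRootEdgeMain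
import Summits.Ventures.PercRepro2.RBRootIsolated
import Summits.Ventures.PercRepro2.RBTwoMarkers
import Summits.Ventures.PercRepro2.RBTwoMarkersMain
import Summits.Ventures.PercRepro2.RBTwoMarkersCross
import Summits.Ventures.PercRepro2.RBTwoMarkersCrossMain
import Summits.Ventures.PercRepro2.RBLeaf
import Summits.Ventures.PercRepro2.RBSeries

/-!
# The series reduction, II: the atoms of a forced pattern and the ratio lemma (mine-a g5; MINE-A.md §36)

`prob_pattern_atom`: under the forced series pattern `(f₁, f₂) = (b₁, b₂)` the atom
`Q ∩ {C(w) = A} ∩ X` is the effective atom of `A ∖ {u}` under `p[f₁ ↦ 0][f₂ ↦ 0][e₀ ↦ 1 or p e₀]`,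
or null, according to whether `(v₁ ∈ A ∧ b₁) ∨ (v₂ ∈ A ∧ b₂)` agrees with `u ∈ A`.
`ratio_split`: `(αa₁ + βa₀)(αb₁ + βb₀)/(αc₁ + βc₀) = α a₁b₁/c₁ + β a₀b₀/c₀` when
`a₁c₀ = a₀c₁` — the consequence of the domain Markov step that makes the split atoms recombine.
-/

namespace Summit.Ventures.PercRepro2

namespace RBSeries

open scoped Classical

section Atoms

variable {V : Type*} {E : Type*} [Fintype E] [DecidableEq E] [Fintype V] {R : Type*} [Field R]
  (ends : E → Sym2 V) (s t w u : V)

/-- The law of a forced pair `(f₁, f₂) = (y, z)`, read under `p`. -/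
lemma prob_forced₂ (p : E → R) (f₁ f₂ : E) (S : Set (Config E)) (y z : Bool) :
    prob (Function.update (Function.update p f₁ (cond y 1 0)) f₂ (cond z 1 0)) S =
      prob p {ω | Function.update (Function.update ω f₁ y) f₂ z ∈ S} := by
  cases y <;> cases z <;> simp only [Bool.cond_true, Bool.cond_false] <;>
    (first
    | rw [RBRootEdge.prob_update_one_eq, RBRootEdge.prob_update_one_eq]
    | rw [RBRootEdge.prob_update_one_eq, RBRootEdge.prob_update_zero_eq]
    | rw [RBRootEdge.prob_update_zero_eq, RBRootEdge.prob_update_one_eq]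
    | rw [RBRootEdge.prob_update_zero_eq, RBRootEdge.prob_update_zero_eq])
    <;> rfl

omit [Fintype V] in
/-- **The atom of a forced series pattern**: under `(f₁, f₂) = (b₁, b₂)`, the atom
`Q ∩ {C(w) = A} ∩ X` is the effective atom of `A ∖ {u}` under `p[f₁ ↦ 0][f₂ ↦ 0][e₀ ↦ 1 or p e₀]`
when `(v₁ ∈ A ∧ b₁) ∨ (v₂ ∈ A ∧ b₂)` agrees with `u ∈ A`, and null otherwise. -/
lemma prob_pattern_atom (p : E → R) {e₀ f₁ f₂ : E} {v₁ v₂ : V} (hends₀ : ends e₀ = s(v₁, v₂))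
    (hends₁ : ends f₁ = s(u, v₁)) (hends₂ : ends f₂ = s(u, v₂)) (hv₁ : v₁ ≠ u) (hv₂ : v₂ ≠ u)
    (h12 : f₁ ≠ f₂) (h01 : e₀ ≠ f₁) (h02 : e₀ ≠ f₂)
    (hz : ∀ e, u ∈ ends e ∧ e ≠ f₁ ∧ e ≠ f₂ → p e = 0) (hwu : w ≠ u) (hsu : s ≠ u) (htu : t ≠ u)
    (X : Set (Config E))
    (hX : ∀ ω : Config E, (∀ e, u ∈ ends e ∧ e ≠ f₁ ∧ e ≠ f₂ → ω e = false) →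
      (ω ∈ X ↔ eff e₀ f₁ f₂ ω ∈ X)) (A : Set V) (b₁ b₂ : Bool) :
    prob (Function.update (Function.update p f₁ (cond b₁ 1 0)) f₂ (cond b₂ 1 0))
        ((connEvent ends s t)ᶜ ∩ clusterEvent ends w A ∩ X) =
      if (((v₁ ∈ A ∧ b₁ = true) ∨ (v₂ ∈ A ∧ b₂ = true)) ↔ u ∈ A) then
        prob (Function.update (Function.update (Function.update p f₁ 0) f₂ 0) e₀ (cond (b₁ && b₂) 1 (p e₀)))
          ((connEvent ends s t)ᶜ ∩ clusterEvent ends w (A \ {u}) ∩ X)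
      else 0 := by
  rw [prob_forced₂ p f₁ f₂ _ b₁ b₂, RBTwoMarkers.prob_inter_closed_of_zero p _ hz]
  -- the forced configuration `ω' = ω[f₁ ↦ b₁][f₂ ↦ b₂]` on «other edges at `u` closed»
  have hcl' : ∀ ω : Config E, (∀ e, u ∈ ends e ∧ e ≠ f₁ ∧ e ≠ f₂ → ω e = false) →
      ∀ e, u ∈ ends e ∧ e ≠ f₁ ∧ e ≠ f₂ → Function.update (Function.update ω f₁ b₁) f₂ b₂ e = false := by
    intro ω hω e he
    rw [Function.update_of_ne he.2.2, Function.update_of_ne he.2.1]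
    exact hω e he
  have hf₁ : ∀ ω : Config E, Function.update (Function.update ω f₁ b₁) f₂ b₂ f₁ = b₁ := by
    intro ω; rw [Function.update_of_ne h12, Function.update_self]
  have hf₂ : ∀ ω : Config E, Function.update (Function.update ω f₁ b₁) f₂ b₂ f₂ = b₂ := by
    intro ω; rw [Function.update_self]
  have heff : ∀ ω : Config E, eff e₀ f₁ f₂ (Function.update (Function.update ω f₁ b₁) f₂ b₂) =
      Function.update (Function.update (Function.update ω e₀ (ω e₀ || (b₁ && b₂))) f₁ false) f₂ false := by
    intro ω
    have := eff_update h12 h01 h02 ω (ω e₀) b₁ b₂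
    rwa [Function.update_eq_self] at this
  -- `u` is isolated in the effective configuration
  have hu0 : ∀ ω : Config E, (∀ e, u ∈ ends e ∧ e ≠ f₁ ∧ e ≠ f₂ → ω e = false) →
      u ∉ cluster ends (Function.update (Function.update (Function.update ω e₀ (ω e₀ || (b₁ && b₂))) f₁
        false) f₂ false) w := by
    intro ω hω hu
    have hcl'' : ∀ e, u ∈ ends e → Function.update (Function.update (Function.update ω e₀
        (ω e₀ || (b₁ && b₂))) f₁ false) f₂ false e = false := by
      intro e he
      by_cases h2 : e = f₂
      · subst h2; exact Function.update_self _ _ _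
      · rw [Function.update_of_ne h2]
        by_cases h1 : e = f₁
        · subst h1; exact Function.update_self _ _ _
        · rw [Function.update_of_ne h1]
          have h0 : e ≠ e₀ := by
            rintro rfl
            rw [hends₀] at he
            rcases Sym2.mem_iff.1 he with h | h
            · exact hv₁ h.symm
            · exact hv₂ h.symm
          rw [Function.update_of_ne h0]
          exact hω e ⟨he, h1, h2⟩
    have : w ∈ cluster ends _ u := conn_symm hu
    rw [RBTwoMarkers.cluster_eq_singleton_of_closed ends u hcl''] at this
    exact hwu this
  -- the cluster condition, on «other edges at `u` closed»
  have hcond : ∀ ω : Config E, (∀ e, u ∈ ends e ∧ e ≠ f₁ ∧ e ≠ f₂ → ω e = false) →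
      cluster ends (Function.update (Function.update ω f₁ b₁) f₂ b₂) w =
        if (v₁ ∈ cluster ends (Function.update (Function.update (Function.update ω e₀
              (ω e₀ || (b₁ && b₂))) f₁ false) f₂ false) w ∧ b₁ = true) ∨
            (v₂ ∈ cluster ends (Function.update (Function.update (Function.update ω e₀
              (ω e₀ || (b₁ && b₂))) f₁ false) f₂ false) w ∧ b₂ = true) then
          insert u (cluster ends (Function.update (Function.update (Function.update ω e₀
            (ω e₀ || (b₁ && b₂))) f₁ false) f₂ false) w)
        else cluster ends (Function.update (Function.update (Function.update ω e₀
          (ω e₀ || (b₁ && b₂))) f₁ false) f₂ false) w := by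
    intro ω hω
    rw [cluster_series ends u hends₀ hends₁ hends₂ hv₁ hv₂ h12 h01 h02 (hcl' ω hω) hwu, heff, hf₁, hf₂]
  have hQX : ∀ ω : Config E, (∀ e, u ∈ ends e ∧ e ≠ f₁ ∧ e ≠ f₂ → ω e = false) →
      ((Function.update (Function.update ω f₁ b₁) f₂ b₂ ∈ (connEvent ends s t)ᶜ ↔
        Function.update (Function.update (Function.update ω e₀ (ω e₀ || (b₁ && b₂))) f₁ false) f₂ false ∈
          (connEvent ends s t)ᶜ) ∧
      (Function.update (Function.update ω f₁ b₁) f₂ b₂ ∈ X ↔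
        Function.update (Function.update (Function.update ω e₀ (ω e₀ || (b₁ && b₂))) f₁ false) f₂ false ∈ X)) := by
    intro ω hω
    constructor
    · simp only [Set.mem_compl_iff, mem_connEvent]
      rw [conn_series ends u hends₀ hends₁ hends₂ hv₂ h12 h01 h02 (hcl' ω hω) hsu htu, heff]
    · rw [hX _ (hcl' ω hω), heff]
  split_ifs with hc
  · -- the effective atom: identify the laws and the sets
    have hr : prob (Function.update (Function.update (Function.update p f₁ 0) f₂ 0) e₀
        (cond (b₁ && b₂) 1 (p e₀))) ((connEvent ends s t)ᶜ ∩ clusterEvent ends w (A \ {u}) ∩ X) =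
        prob p {ω | Function.update (Function.update (Function.update ω e₀ (ω e₀ || (b₁ && b₂))) f₁ false)
          f₂ false ∈ (connEvent ends s t)ᶜ ∩ clusterEvent ends w (A \ {u}) ∩ X} := by
      cases hb : (b₁ && b₂)
      · rw [Bool.cond_false, Function.update_eq_self_iff.2
          (by rw [Function.update_of_ne h02, Function.update_of_ne h01])]
        have := prob_forced₂ p f₁ f₂ ((connEvent ends s t)ᶜ ∩ clusterEvent ends w (A \ {u}) ∩ X)
          false false
        simp only [Bool.cond_false] at this
        rw [this]
        congr 1
        ext ω
        simp only [Set.mem_setOf_eq, Bool.or_false, Function.update_eq_self]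
      · rw [Bool.cond_true, Function.update_comm h02.symm, Function.update_comm h01.symm]
        have := prob_forced p e₀ f₁ f₂ ((connEvent ends s t)ᶜ ∩ clusterEvent ends w (A \ {u}) ∩ X)
          true false false
        simp only [Bool.cond_true, Bool.cond_false] at this
        rw [this]
        congr 1
        ext ω
        simp only [Set.mem_setOf_eq, Bool.or_true]
    rw [hr, RBTwoMarkers.prob_inter_closed_of_zero p _ hz
      {ω | Function.update (Function.update (Function.update ω e₀ (ω e₀ || (b₁ && b₂))) f₁ false) f₂ false ∈
        (connEvent ends s t)ᶜ ∩ clusterEvent ends w (A \ {u}) ∩ X}]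
    congr 1
    ext ω
    constructor
    · rintro ⟨h, hω⟩
      refine ⟨?_, hω⟩
      obtain ⟨⟨hQ, hC⟩, hXω⟩ := h
      refine ⟨⟨(hQX ω hω).1.1 hQ, ?_⟩, (hQX ω hω).2.1 hXω⟩
      rw [mem_clusterEvent] at hC ⊢
      rw [hcond ω hω] at hC
      split_ifs at hC with hcnd
      · rw [← hC, Set.insert_sdiff_self_of_notMem (hu0 ω hω)]
      · have hu' : u ∉ A := by rw [← hC]; exact hu0 ω hω
        rw [Set.sdiff_singleton_eq_self hu', hC]
    · rintro ⟨h, hω⟩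
      refine ⟨?_, hω⟩
      obtain ⟨⟨hQ, hC⟩, hXω⟩ := h
      refine ⟨⟨(hQX ω hω).1.2 hQ, ?_⟩, (hQX ω hω).2.2 hXω⟩
      rw [mem_clusterEvent] at hC ⊢
      rw [hcond ω hω, hC]
      have hmem : ∀ v, v ≠ u → (v ∈ A \ {u} ↔ v ∈ A) := fun v hv => by simp [hv]
      split_ifs with hcnd
      · have hu' : u ∈ A := hc.1 (by
          rcases hcnd with ⟨h1, h2⟩ | ⟨h1, h2⟩
          · exact Or.inl ⟨(hmem v₁ hv₁).1 h1, h2⟩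
          · exact Or.inr ⟨(hmem v₂ hv₂).1 h1, h2⟩)
        rw [Set.insert_sdiff_singleton, Set.insert_eq_of_mem hu']
      · have hu' : u ∉ A := by
          intro hu'
          apply hcnd
          rcases hc.2 hu' with ⟨h1, h2⟩ | ⟨h1, h2⟩
          · exact Or.inl ⟨(hmem v₁ hv₁).2 h1, h2⟩
          · exact Or.inr ⟨(hmem v₂ hv₂).2 h1, h2⟩
        rw [Set.sdiff_singleton_eq_self hu']
  · -- the null case
    unfold prob
    refine Finset.sum_eq_zero fun ω _ => Set.indicator_of_notMem ?_ _
    rintro ⟨⟨⟨_, hC⟩, _⟩, hω⟩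
    rw [mem_clusterEvent, hcond ω hω] at hC
    have hmem : ∀ v, v ≠ u → (v ∈ A \ {u} ↔ v ∈ A) := fun v hv => by simp [hv]
    split_ifs at hC with hcnd
    · apply hc
      have hu' : u ∈ A := hC ▸ Set.mem_insert u _
      have hCE' : cluster ends (Function.update (Function.update (Function.update ω e₀
          (ω e₀ || (b₁ && b₂))) f₁ false) f₂ false) w = A \ {u} := by
        rw [← hC, Set.insert_sdiff_self_of_notMem (hu0 ω hω)]
      rw [hCE'] at hcnd
      refine ⟨fun _ => hu', fun _ => ?_⟩
      rcases hcnd with ⟨h1, h2⟩ | ⟨h1, h2⟩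
      · exact Or.inl ⟨(hmem v₁ hv₁).1 h1, h2⟩
      · exact Or.inr ⟨(hmem v₂ hv₂).1 h1, h2⟩
    · apply hc
      have hu' : u ∉ A := by rw [← hC]; exact hu0 ω hω
      rw [hC] at hcnd
      exact ⟨fun h => absurd h hcnd, fun h => absurd h hu'⟩

omit [Fintype V] in
/-- **Boundary atoms are null with the edge forced open**: for `e₀ = {v₁, v₂}` with `v₁ ∈ A ∌ v₂`,
`P_{e₀ ↦ 1}(Q ∩ {C(w) = A} ∩ X) = 0`. -/
lemma prob_update_one_atom_boundary (q : E → R) {e₀ : E} {v₁ v₂ : V} (hends₀ : ends e₀ = s(v₁, v₂))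
    (X : Set (Config E)) {A : Set V} (hv₁ : v₁ ∈ A) (hv₂ : v₂ ∉ A) :
    prob (Function.update q e₀ 1) ((connEvent ends s t)ᶜ ∩ clusterEvent ends w A ∩ X) = 0 := by
  rw [← prob_update_one_inter_openEdge]
  unfold prob
  refine Finset.sum_eq_zero fun ω _ => Set.indicator_of_notMem ?_ _
  rintro ⟨⟨⟨_, hC⟩, _⟩, ho⟩
  rw [mem_clusterEvent] at hC
  rw [mem_openEdge] at ho
  apply hv₂
  rw [← hC] at hv₁ ⊢
  exact conn_trans hv₁ (conn_of_openAdj ⟨e₀, ho, hends₀⟩)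

omit [Fintype E] [DecidableEq E] [Fintype V] in
/-- **The ratio lemma**: with `a₁ c₀ = a₀ c₁`, `b₁ c₀ = b₀ c₁`, nonnegative coefficients and
denominators, and `c = 0 → a = b = 0` on each side,
`(αa₁ + βa₀)(αb₁ + βb₀)/(αc₁ + βc₀) = α·a₁b₁/c₁ + β·a₀b₀/c₀`. -/
lemma ratio_split [LinearOrder R] [IsStrictOrderedRing R] {a₁ a₀ b₁ b₀ c₁ c₀ α β : R}
    (ha : a₁ * c₀ = a₀ * c₁) (hb : b₁ * c₀ = b₀ * c₁) (hα : 0 ≤ α) (hβ : 0 ≤ β) (hc₁ : 0 ≤ c₁)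
    (hc₀ : 0 ≤ c₀) (hz₁ : c₁ = 0 → a₁ = 0 ∧ b₁ = 0) (hz₀ : c₀ = 0 → a₀ = 0 ∧ b₀ = 0) :
    (α * a₁ + β * a₀) * (α * b₁ + β * b₀) / (α * c₁ + β * c₀) =
      α * (a₁ * b₁ / c₁) + β * (a₀ * b₀ / c₀) := by
  rcases eq_or_ne c₁ 0 with h1 | h1
  · obtain ⟨ha1, hb1⟩ := hz₁ h1
    subst h1; subst ha1; subst hb1
    simp only [mul_zero, zero_add, div_zero]
    exact RBLeaf.mul_div_mul_self' β a₀ b₀ c₀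
  rcases eq_or_ne c₀ 0 with h0 | h0
  · obtain ⟨ha0, hb0⟩ := hz₀ h0
    subst h0; subst ha0; subst hb0
    simp only [mul_zero, add_zero, div_zero]
    exact RBLeaf.mul_div_mul_self' α a₁ b₁ c₁
  -- both denominators nonzero: the polynomial identity
  have key : (α * a₁ + β * a₀) * (α * b₁ + β * b₀) * (c₁ * c₀) =
      (α * (a₁ * b₁) * c₀ + β * (a₀ * b₀) * c₁) * (α * c₁ + β * c₀) := by
    have e1 : a₁ * c₀ - a₀ * c₁ = 0 := sub_eq_zero.2 ha
    have : (α * a₁ + β * a₀) * (α * b₁ + β * b₀) * (c₁ * c₀) -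
        (α * (a₁ * b₁) * c₀ + β * (a₀ * b₀) * c₁) * (α * c₁ + β * c₀) =
        -(α * β * (a₁ * c₀ - a₀ * c₁) * (b₁ * c₀ - b₀ * c₁)) := by ring
    rw [e1] at this
    linarith
  rcases eq_or_ne (α * c₁ + β * c₀) 0 with hd | hd
  · have hαc : α * c₁ = 0 := by nlinarith [mul_nonneg hα hc₁, mul_nonneg hβ hc₀]
    have hβc : β * c₀ = 0 := by nlinarith [mul_nonneg hα hc₁, mul_nonneg hβ hc₀]
    rcases mul_eq_zero.1 hαc with hα0 | hc
    · rcases mul_eq_zero.1 hβc with hβ0 | hc'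
      · subst hα0; subst hβ0; simp
      · exact absurd hc' h0
    · exact absurd hc h1
  · rw [div_eq_iff hd]
    have hc : c₁ * c₀ ≠ 0 := mul_ne_zero h1 h0
    have : (α * (a₁ * b₁ / c₁) + β * (a₀ * b₀ / c₀)) * (α * c₁ + β * c₀) =
        (α * (a₁ * b₁) * c₀ + β * (a₀ * b₀) * c₁) * (α * c₁ + β * c₀) / (c₁ * c₀) := by
      field_simp
      try ring
    rw [this, ← key, mul_div_cancel_right₀ _ hc]

omit [Fintype E] [DecidableEq E] in
/-- **The split-atom sum**: if `F A + F (insert u A) = G A` for `u ∉ A` and `G` vanishes on atoms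
containing `u`, then `∑ F = ∑ G`. -/
lemma sum_split_pair (F G : Set V → R) (u : V) (hG : ∀ A, u ∈ A → G A = 0)
    (h : ∀ A, u ∉ A → F A + F (insert u A) = G A) : ∑ A : Set V, F A = ∑ A : Set V, G A := by
  rw [← Finset.sum_filter_add_sum_filter_not Finset.univ (fun A : Set V => u ∈ A),
    ← Finset.sum_filter_add_sum_filter_not Finset.univ (fun A : Set V => u ∈ A) G,
    Finset.sum_eq_zero (fun A hA => hG A (Finset.mem_filter.1 hA).2), zero_add]
  have h1 : ∑ A ∈ Finset.univ.filter (fun A : Set V => u ∈ A), F A =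
      ∑ A ∈ Finset.univ.filter (fun A : Set V => ¬ u ∈ A), F (insert u A) := by
    refine Finset.sum_nbij' (fun A => A \ {u}) (fun A => insert u A) ?_ ?_ ?_ ?_ ?_
    · intro A _
      simp only [Finset.mem_filter, Finset.mem_univ, true_and, Set.mem_sdiff, Set.mem_singleton_iff,
        not_true_eq_false, and_false, not_false_eq_true]
    · intro A _
      simp only [Finset.mem_filter, Finset.mem_univ, true_and]
      exact Set.mem_insert u A
    · intro A hA
      simp only [Finset.mem_filter, Finset.mem_univ, true_and] at hA
      rw [Set.insert_sdiff_singleton, Set.insert_eq_of_mem hA]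
    · intro A hA
      simp only [Finset.mem_filter, Finset.mem_univ, true_and] at hA
      exact Set.insert_sdiff_self_of_notMem hA
    · intro A hA
      simp only [Finset.mem_filter, Finset.mem_univ, true_and] at hA
      rw [Set.insert_sdiff_singleton, Set.insert_eq_of_mem hA]
  rw [h1, ← Finset.sum_add_distrib]
  refine Finset.sum_congr rfl fun A hA => ?_
  simp only [Finset.mem_filter, Finset.mem_univ, true_and] at hA
  rw [add_comm]
  exact h A hA

end Atoms

end RBSeries

end Summit.Ventures.PercRepro2
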